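import Mathlib
import Summits.RiemannHypothesis.RiemannHypothesis.Theorems.ScrewManifestCertDefs

/-!
# RH-FREE margin ceiling for manifest certificates (sos-theory g18, 2026-08-26; HOME/sos/lean/ManifestMargin.lean — landable verbatim as Theorems/ScrewManifestMargin.lean)

For ANY manifest decomposition `R = S_{n+1} − Σ_k w_k A_{t_k} − wJ·J` with nonnegative weights, the
strict-DD row slacks `e_i := R_ii − Σ_{j≠i} |R_ij|` satisfy, for every pair `i ≠ j`,
`e_i + e_j ≤ 2·Ψ(x_i − x_j)` (indeed `≤ 2η(x_i − x_j)`, `η = Ψ − φ_ν ≤ Ψ`).  In particular the margin of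
any certificate of `S_M` is at most `Ψ(log(M/(M−1))) ≈ (1.5 log M)/(π M)`: a certificate must control
each row's `M − 2` off-diagonal entries to a TOTAL error below that (mechanism (i) of the height law).
Nothing here bears on the truth of RH.
-/

-- `Summit.RiemannHypothesis.RiemannHypothesis.…` duplicates `RiemannHypothesis` BY DESIGN (D-0017).
set_option linter.dupNamespace false
set_option autoImplicit false

namespace Summit.RiemannHypothesis.RiemannHypothesis.Theorems.IntegerScrew.Manifest

open Literature.NumberTheory.LFunctions Matrix Finset

/-- Row slack of a real square matrix at row `i`: `R i i − Σ_{j ≠ i} |R i j|`. -/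
noncomputable def rowSlack {n : ℕ} (R : Matrix (Fin n) (Fin n) ℝ) (i : Fin n) : ℝ :=
  R i i - ∑ j ∈ univ.erase i, |R i j|

/-- RH-FREE statement slot: the pairwise margin ceiling. -/
def MarginCeiling : Prop :=
  ∀ (n K : ℕ) (t w : Fin K → ℝ) (wJ : ℝ), (∀ k, 0 ≤ w k) →
    ∀ i j : Fin n, i ≠ j →
      rowSlack (remainder n K t w wJ) i + rowSlack (remainder n K t w wJ) j
        ≤ 2 * zetaScrew (node n i - node n j)

/-- RH-FREE conjecture slot (sos-theory g18, SCREW-P3-HEIGHT-LAW §4): the manifest-certificate height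
grows faster than linearly in `M` — for every slope `C` certificates eventually need frequencies above
`C·M`.  (Trivially true if RH fails; under RH it is the substantive obstruction law; the model of §3
predicts `T_DD(M)/M ≍ n(T)^{α}`, `α ≈ 0.17` measured on `M = 32…128`.)  No constant asserted. -/
def SuperlinearFloor : Prop :=
  ∀ C : ℝ, ∃ n₀ : ℕ, ∀ n : ℕ, n₀ ≤ n → ∀ tmin : ℝ, 0 < tmin → ¬ ManifestCert n tmin (C * (n + 1))

/-- RH-CONDITIONAL conjecture slot, the matching ceiling with the empirical exponent left free:
under RH certificates exist by height `C·M·(log M)^a` for some `a < 1` (the census law is then strictly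
between linear and `M log M`). -/
def SublogCeiling : Prop :=
  _root_.RiemannHypothesis →
    ∃ (C a : ℝ), a < 1 ∧ ∀ n : ℕ, 7 ≤ n → ManifestCert n (1 / 10) (C * (n + 1) * Real.log (n + 1) ^ a)

/-- A superlinear floor excludes every linear ceiling: if `SuperlinearFloor` holds then for no slope `C`
do manifest certificates of `S_{n+1}` (with `tmin = 1/10`) exist by height `C·(n+1)` for all `n ≥ 7`
(pure logic on the two slots; RH-free). -/
theorem superlinearFloor_imp_not_linear_ceiling (h : SuperlinearFloor) (C : ℝ) :
    ¬ (∀ n : ℕ, 7 ≤ n → ManifestCert n (1 / 10) (C * (n + 1))) := by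
  intro hC
  obtain ⟨n₀, hn₀⟩ := h C
  exact hn₀ (max n₀ 7) (le_max_left _ _) (1 / 10) (by norm_num) (hC _ (le_max_right _ _))

/-! ## Proof of the margin ceiling -/

/-- Diagonal-minus-off-diagonal combination of a wave atom:
`A_t(i,i) + A_t(j,j) − 2A_t(i,j) = 2(1 − cos(t(x_i − x_j)))/t²`. -/
private lemma waveAtom_diag_sub (n : ℕ) (t : ℝ) (i j : Fin n) :
    waveAtom n t i i + waveAtom n t j j - 2 * waveAtom n t i j
      = 2 * ((1 - Real.cos (t * (node n i - node n j))) / t ^ 2) := by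
  simp only [waveAtom, Matrix.of_apply, sub_self, mul_zero, Real.cos_zero]
  ring

/-- `(1 − cos(tu))/t² ≥ 0`. -/
private lemma phi_nonneg (t u : ℝ) : 0 ≤ (1 - Real.cos (t * u)) / t ^ 2 :=
  div_nonneg (by linarith [Real.cos_le_one (t * u)]) (sq_nonneg t)

/-- **The margin ceiling holds** (RH-free): for any manifest decomposition with nonnegative wave
weights and any `i ≠ j`, `rowSlack R i + rowSlack R j ≤ 2Ψ(x_i − x_j)` — each slack is at most the
diagonal entry minus one off-diagonal modulus, `S_ii + S_jj − S_ij − S_ji = 2Ψ(x_i − x_j)` (`Ψ` even,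
`Ψ(0) = 0`), the wave atoms contribute `w_k·2(1 − cos)/t² ≥ 0` to the same combination and the `wJ·J`
terms cancel. -/
theorem marginCeiling_proof : MarginCeiling := by
  intro n K t w wJ hw i j hij
  set R := remainder n K t w wJ with hR
  -- slack ≤ diagonal − one off-diagonal entry
  have hi : rowSlack R i ≤ R i i - |R i j| := by
    unfold rowSlack
    have : |R i j| ≤ ∑ k ∈ univ.erase i, |R i k| :=
      single_le_sum (f := fun k => |R i k|) (fun _ _ => abs_nonneg _)
        (mem_erase.mpr ⟨hij.symm, mem_univ _⟩)
    linarith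
  have hj : rowSlack R j ≤ R j j - |R j i| := by
    unfold rowSlack
    have : |R j i| ≤ ∑ k ∈ univ.erase j, |R j k| :=
      single_le_sum (f := fun k => |R j k|) (fun _ _ => abs_nonneg _)
        (mem_erase.mpr ⟨hij, mem_univ _⟩)
    linarith
  -- entries of S and of R
  have hSab : ∀ a b : Fin n, screwMatrix n a b
      = zetaScrew (node n a) + zetaScrew (node n b) - zetaScrew (node n a - node n b) := fun a b => rfl
  have hS : screwMatrix n i i + screwMatrix n j j - screwMatrix n i j - screwMatrix n j i
      = 2 * zetaScrew (node n i - node n j) := by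
    rw [hSab, hSab, hSab, hSab, sub_self, sub_self, zetaScrew_zero,
      ← zetaScrew_neg (node n j - node n i), neg_sub]
    ring
  have hRe : ∀ a b : Fin n, R a b = screwMatrix n a b - (∑ k, w k * waveAtom n (t k) a b) - wJ := by
    intro a b
    simp only [hR, remainder, Matrix.sub_apply, Matrix.smul_apply, Matrix.sum_apply, onesMat,
      Matrix.of_apply, smul_eq_mul, mul_one]
  have hsym : ∀ k, waveAtom n (t k) j i = waveAtom n (t k) i j := by
    intro k
    simp only [waveAtom, Matrix.of_apply]
    rw [show t k * (node n j - node n i) = -(t k * (node n i - node n j)) by ring, Real.cos_neg]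
    ring
  have hA : ∀ k, 0 ≤ w k * (waveAtom n (t k) i i + waveAtom n (t k) j j
      - waveAtom n (t k) i j - waveAtom n (t k) j i) := by
    intro k
    rw [hsym k, show waveAtom n (t k) i i + waveAtom n (t k) j j - waveAtom n (t k) i j
        - waveAtom n (t k) i j = waveAtom n (t k) i i + waveAtom n (t k) j j
        - 2 * waveAtom n (t k) i j by ring, waveAtom_diag_sub]
    exact mul_nonneg (hw k) (mul_nonneg (by norm_num) (phi_nonneg (t k) (node n i - node n j)))
  have hsum : 0 ≤ ∑ k, w k * (waveAtom n (t k) i i + waveAtom n (t k) j j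
      - waveAtom n (t k) i j - waveAtom n (t k) j i) := sum_nonneg fun k _ => hA k
  have hsplit : ∑ k, w k * (waveAtom n (t k) i i + waveAtom n (t k) j j
      - waveAtom n (t k) i j - waveAtom n (t k) j i)
      = (∑ k, w k * waveAtom n (t k) i i) + (∑ k, w k * waveAtom n (t k) j j)
        - (∑ k, w k * waveAtom n (t k) i j) - (∑ k, w k * waveAtom n (t k) j i) := by
    simp only [mul_add, mul_sub, Finset.sum_add_distrib, Finset.sum_sub_distrib]
  have hcomb : R i i + R j j - R i j - R j i ≤ 2 * zetaScrew (node n i - node n j) := by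
    rw [hRe i i, hRe j j, hRe i j, hRe j i, ← hS]
    linarith [hsum, hsplit]
  have h1 : R i j ≤ |R i j| := le_abs_self _
  have h2 : R j i ≤ |R j i| := le_abs_self _
  linarith

/-- Corollary (RH-FREE): the DD margin of ANY manifest certificate of `S_{n+1}` is at most `Ψ` at the
top gap `log((n+1)/n)` — every certificate has SOME row with slack `≤ Ψ(x_{n-1} − x_{n-2})`. -/
theorem min_rowSlack_le_top_gap (n K : ℕ) (t w : Fin K → ℝ) (wJ : ℝ) (hw : ∀ k, 0 ≤ w k)
    (hn : 2 ≤ n) :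
    ∃ i : Fin n, rowSlack (remainder n K t w wJ) i
      ≤ zetaScrew (node n ⟨n - 1, by omega⟩ - node n ⟨n - 2, by omega⟩) := by
  have hij : (⟨n - 1, by omega⟩ : Fin n) ≠ ⟨n - 2, by omega⟩ := by
    intro h; have := congrArg Fin.val h; simp at this; omega
  have := marginCeiling_proof n K t w wJ hw _ _ hij
  by_contra hc
  simp only [not_exists, not_le] at hc
  have h1 := hc ⟨n - 1, by omega⟩
  have h2 := hc ⟨n - 2, by omega⟩
  linarith

end Summit.RiemannHypothesis.RiemannHypothesis.Theorems.IntegerScrew.Manifest
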